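/-
Copyright: reproduction cell `pub-balaban` (paper sub-cell B04, gen 8). Imports the gen-7 kernel `B4RandomWalk213` only.
Source under audit: T. Bałaban, *Regularity and decay of lattice Green's functions*, Commun. Math. Phys. 89
(1983) 571–597 — bib key `Balaban1983RegularityDecay` ("B4"). Journal page = PDF page + 570.
-/
import Literature.MathematicalPhysics.QuantumFieldTheory.Balaban1983to89.B4RandomWalk213

/-!
# B4 (1.11)–(1.12) / Corollary 2.3, the `δG_k(Ω,Ω₀,A)` clause: cancellation of two random-walk expansions

This module is a KERNEL CERTIFICATE OF PRINTED BOOKKEEPING, the corollary of `B4RandomWalk213` announced there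
under "What it does NOT prove". It types, over an arbitrary (noncommutative) normed ring, the three-sentence
argument of B4 p. 579 by which the decay bounds for a propagator transfer to the DIFFERENCE of the propagators of
two domains `Ω ⊂ Ω₀` with an extra exponential factor in the distances to `Ωᶜ`: the two walk expansions (2.13)
have the same factors at every label whose cube is interior to `Ω` ⇒ every walk avoiding the remaining label set
`T` contributes the same term to both and CANCELS ⇒ only walks from `S₀` to `S₁` THROUGH `T` survive ⇒ their
length is at least `N = inf_{t ∈ T}(d(S₀,t) + d(t,S₁))` ⇒ the geometric bound of (2.22)/(2.30) with the factor `2`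
(*"with 2^{d+1} instead of 2^d"*) and the longer `N`. Nothing about the actual lattice operators is asserted (see
"What it does NOT prove").

## Text under audit (verbatim, B4)

* p. 573, (1.11)–(1.12): *"If Ω ⊂ Ω₀, then for δG_k(Ω,Ω₀,A) defined by the equality (1.11) δG_k(Ω,Ω₀,A) =
  G_k(Ω,A) − G_k(Ω₀,A), we have the inequalities (1.5) and (1.6) (with the same restrictions on x, x') with the
  additional factor (1.12) exp(−δ₀ dist(supp f, Ω^c) − δ₀ dist(supp f, Ω^c)) on the right hand sides."* (the
  doubled `supp f` and "(1.5) and (1.6)" for (1.9) and (1.10) are print defects recorded by the cell, GAPS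
  G-B4-01/G-B4-01a; the reading is fixed by the two passages below).
* p. 579, between (2.22) and (2.23): *"To prove the corresponding inequalities for δG_k(Ω,Ω₀,A) = G_k(Ω,A) −
  G_k(Ω₀,A) with Ω ⊂ Ω₀, we take the representations (2.13) for both propagators. The terms with ω such that
  □_{ω_i} are interior cubes of Ω are the same in both representations, so they cancel in the difference, and for
  δG_k we get a representation similar to (2.13) with the additional restriction that at least one □_{ω_i}
  intersects the boundary ∂Ω. We estimate the terms of the representation as above and we get the first
  inequality in (2.22) with 2^{d+1} instead of 2^d and with the restriction
  n ≥ M^{−1} sup_{x₁∈Ω^c}(dist({x,x'},x₁) + dist(x₁, supp f)) − 3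
  ≥ (2M)^{−1}(dist({x,x'}, supp f) + dist({x,x'}, Ω^c) + dist(supp f, Ω^c)) − 3. It implies all the inequalities
  we need."* (⟦sic⟧: the printed `sup_{x₁∈Ω^c}` must be read `inf_{x₁∈Ω^c}` — a lower bound on the length of EVERY
  surviving walk is the infimum over the exit point `x₁`, and only the infimum satisfies the printed second
  inequality; recorded in the cell's transcript of p. 579 and in DIVERGENCE D-b04g8-1; the `inf` reading is what is
  typed below, as a hypothesis quantified over all `t ∈ T`).
* p. 581, end of Corollary 2.3: *"The same inequalities hold for δG_k(Ω,Ω₀,A) with the additional factor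
  e^{−δ₀(dist(supp f,Ω^c) + dist(supp f',Ω^c))}."* … *"Of course it is enough to prove it for f, f' with supports in
  unit cubes, and the proof proceeds as before using only the L²-bounds of Lemma 2.1."*
* p. 577, (2.13) and its "obvious fact", p. 579 *"There are at most 2^d(3^d)^{n−1}2^d of such paths"*: see the
  header of `B4RandomWalk213`, whose dictionary is kept.

## Dictionary (abstract ↦ B4), in addition to that of `B4RandomWalk213`

* ONE finite label type `ι` ↦ the centres `j ∈ ℤ^d` of the cubes `□_j` of the LARGER domain `Ω₀`; the unprimed
  family `a j ↦ h_jG_k(□_j^Ω,Ã_j)h_j`, `b j ↦ K_jG_k(□_j^Ω,Ã_j)h_j` is the expansion (2.13) of `G_k(Ω,A)` (with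
  `a j = b j = 0` at labels whose cube does not meet `Ω`), the primed family `a' j`, `b' j` that of `G_k(Ω₀,A)`;
  `G ↦ G_k(Ω,A)`, `G' ↦ G_k(Ω₀,A)`, so `G − G' ↦ δG_k(Ω,Ω₀,A)` of (1.11).
* the label set `T` ↦ the labels `j` whose cube `□_j` is NOT an interior cube of `Ω` (it meets `∂Ω` or lies
  outside `Ω`); the AGREEMENT hypotheses `a j = a' j`, `b j = b' j` for `j ∉ T` ↦ *"The terms with ω such that
  □_{ω_i} are interior cubes of Ω are the same in both representations"* (for an interior cube the set `□_j`, the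
  field `Ã_j` and the function `h_j` do not depend on the domain — the cell's reading, GAPS G-B4-01, transcript
  caveat to p. 579; it is a HYPOTHESIS here).
* `Avoids T j ys` ↦ no cube of the path is one of those; its negation ↦ *"at least one □_{ω_i} intersects the
  boundary ∂Ω"* (or lies outside `Ω`).
* `N` with `N ≤ d(i,t) + d(t,l)` for all `i ∈ S₀`, `t ∈ T`, `l ∈ S₁` (sup-distance of labels, witnessed
  coordinatewise) ↦ the printed *"n ≥ M^{−1} sup_{x₁∈Ω^c}* ⟦sic: inf⟧ *(dist({x,x'},x₁) + dist(x₁, supp f)) −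
  3"*; the printed second step *"≥ (2M)^{−1}(dist({x,x'}, supp f) + dist({x,x'}, Ω^c) + dist(supp f, Ω^c)) −
  3"* is the metric triangle inequality `half_sum_le_dist_through`.

## What this module proves (all elementary; every `theorem` below is proved in full)

* §1 (any ring): agreement off `T` ⇒ the path terms of a walk AVOIDING `T` coincide (`bprod_congr_off`,
  `path_term_congr_off`); a single cut path term `P·a_{ω₀}b_{ω₁}⋯b_{ω_n}·P'` vanishes unless `ω₀ ∈ S₀` and
  `ω_n ∈ S₁` (`cut_path_term_eq_zero`).
* §2 (finite sums): **CANCELLATION** — the order-`n` term of the difference of the two Neumann series, cut off on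
  both sides, equals the sum over walks NOT avoiding `T` of the difference of the two path terms
  (`diff_cut_order_term_eq`) — *"they cancel in the difference, and for δG_k we get a representation similar to
  (2.13) with the additional restriction that at least one □_{ω_i} intersects the boundary"*; hence the terms of
  order `n < N` vanish when every walk from `S₀` to `S₁` through `T` has `≥ N` steps
  (`diff_cut_order_term_eq_zero`).
* §3 (normed ring): the order-`(m+1)` term of the difference has norm `≤ 2·|S₀|·D^{m+1}·αβ^mβ₁`
  (`norm_diff_cut_order_term_le`, *"2^{d+1} instead of 2^d"*), and **THE BOUND**
  `‖P(G − G')P'‖ ≤ 2·|S₀|·α·β₁·D·(Dβ)^{N−1}/(1 − Dβ)` (`walk_delta_bound`), with its exponential repackaging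
  `walk_delta_bound_exp` (`Dβ ≤ e^{−δ}` ⇒ factor `e^{−δ(N−1)}`): the shape of (1.12) / of the `δG_k` clause of
  Corollary 2.3, the extra decay coming ONLY from the larger number of steps `N`.
* §4 (the `ℤ^d` model of `B4RandomWalk213` §5): along a cube-walk the `k`-th point is within sup-distance `k + 1`
  of the start and `n − 1 − k` of the end (`prefix_displacement`, `suffix_displacement`); hence a walk from `S₀`
  to `S₁` through a label `t ∈ T` has at least `d(S₀,t) + d(t,S₁)` steps (`le_length_of_through`,
  `through_of_separations`), the specialisation `lattice_walk_delta_bound` (`D = 3^d`), and the metric step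
  `(dist(x,y) + dist(x,C) + dist(y,C))/2 ≤ dist(x,x₁) + dist(x₁,y)` for `x₁ ∈ C` (`half_sum_le_dist_through`),
  which is the printed passage from the first to the second expression for the restriction on `n`.

## What it does NOT prove (prose only; cell records GAPS.md C-b04g8-1, DIVERGENCE.md D-b04g8-1)

* everything listed under "What it does NOT prove" in `B4RandomWalk213` (the operators, (2.9)–(2.11), Lemma 2.1,
  the smallness of `R`, the identification of `N` with `M^{−1}dist − 3`, the constants `c₀, δ₀`);
* that the cubes, fields `Ã_j` and functions `h_j` built for `Ω` and for `Ω₀` coincide at interior cubes of `Ω`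
  (the AGREEMENT hypotheses `ha`, `hb`) — a property of the construction of p. 575, hypothesis here;
* the Hölder-norm version (1.9) of the clause (the `L^p → L^q` chain (2.18)–(2.21) is not typed in this lineage);
  only the operator-norm ("L²", Corollary 2.3) shape is typed, exactly as for (2.30) in `B4RandomWalk213`;
* any instance of the sibling interfaces named below (no sibling module is imported or instantiated).

## Sibling typings in this directory (not imported; stated so that no reader counts anything twice)

* `B6DomainChange` (cell b06) types the SHAPE (1.12) for kernels on a pseudo-metric index set by the § 5 route of
  B4 (`B4Sect5Torus.deltaC_bound` = (5.8)/(5.10), `B4Sect5Proof.inv_sub_inv_eq`), not by walk cancellation;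
* `B9Locality` (cell pv05) types the CANCELLATION SENTENCE of B9 Thm 3.14 (*"in the difference all terms for walks
  with localizations contained in Ω are cancelled"*) for data-dependent unit factors over its `RWModel`
  (`sum_sub_sum_eq_sum_touching`, `tsum_sub_tsum_eq_tsum_touching`); §2 below is the same sentence in the (2.13)
  index model of `B4RandomWalk213` (two factor families on one label type agreeing off `T`), which is what the
  counting and cut-off lemmas of that module consume;
* `B9Thm314` (cell b09) takes both the cancellation (`DiffExpansionPrinted`) and the step count of the B4 template
  (`StepCountPrinted`, *"derivable … not derived here"*) as HYPOTHESES over an abstract `RWExpansion`; the present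
  module PROVES the step count in the `ℤ^d` cube model (§4: `prefix_displacement`, `suffix_displacement`,
  `le_length_of_through`) and the assembled bound with the vanishing low orders (§3: `walk_delta_bound`), for the
  B4 expansion (2.13) — it does not discharge `B9Thm314`'s hypotheses, whose walk and term data are B9's.

## References (source-labelled)

* `B4RandomWalk213` (this directory, gen 7 of this lineage): `bprod`, `lastPt`, `IsWalk`, `walks`, `cubeAdj`,
  `cut_order_term_eq`, `mul_bprod_mul_eq_zero_of_last`, `norm_cut_order_term_le`, `card_cubeAdj_le`,
  `walk_displacement` — every input of the present file;
* Mathlib: `HasSum.sub`, `hasSum_nat_add_iff'`, `hasSum_geometric_of_lt_one`, `HasSum.norm_le_of_bounded`,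
  `Metric.infDist_le_dist_of_mem` [folklore];
* every theorem below is elementary finite algebra / counting / a geometric series / the triangle inequality,
  proved in full here; nothing is cited as a hypothesis, and the manuscript under audit is quoted, never invoked.

Version log: v1 (this file) — 2026-08-19, planner-b2b-balaban-b04-g8-0.
-/

namespace Literature.MathematicalPhysics.QuantumFieldTheory.Balaban1983to89.B4RandomWalkDelta112

open Finset
open Literature.MathematicalPhysics.QuantumFieldTheory.Balaban1983to89.B4RandomWalk213

/-! ### §1 Walks avoiding a label set; agreement off the set ⇒ equal path terms; cut-offs -/

section Tuples

variable {R : Type*} [Ring R] {ι : Type*}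

/-- the path `(j, ys 0, …, ys (n−1))` AVOIDS the label set `T`: none of its points lies in `T` — the negation of
the printed *"at least one □_{ω_i} intersects the boundary ∂Ω"*. [cite: Balaban1983RegularityDecay, p.579 after
(2.22)] -/
def Avoids (T : Finset ι) (j : ι) {n : ℕ} (ys : Fin n → ι) : Prop :=
  j ∉ T ∧ ∀ k : Fin n, ys k ∉ T

/-- `Avoids` is decidable (the non-avoiding walks form a `Finset`). [folklore] -/
instance Avoids.instDecidable [DecidableEq ι] (T : Finset ι) (j : ι) {n : ℕ} (ys : Fin n → ι) :
    Decidable (Avoids T j ys) :=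
  inferInstanceAs (Decidable (j ∉ T ∧ ∀ k : Fin n, ys k ∉ T))

/-- the trivial path avoids `T` iff its only point does. [folklore] -/
@[simp] theorem avoids_zero {T : Finset ι} {j : ι} {ys : Fin 0 → ι} : Avoids T j ys ↔ j ∉ T :=
  ⟨fun h => h.1, fun h => ⟨h, fun k => k.elim0⟩⟩

/-- recursion: `(j, ys)` avoids `T` iff `j ∉ T` and `(ys 0, tail ys)` avoids `T`. [folklore] -/
theorem avoids_succ {T : Finset ι} {j : ι} {n : ℕ} {ys : Fin (n + 1) → ι} :
    Avoids T j ys ↔ j ∉ T ∧ Avoids T (ys 0) (Fin.tail ys) := by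
  unfold Avoids
  rw [Fin.forall_fin_succ]
  rfl

/-- NOT avoiding `T` means: the starting label or some later label lies in `T` — *"at least one □_{ω_i} intersects
the boundary ∂Ω"*. [cite: Balaban1983RegularityDecay, p.579 after (2.22)] -/
theorem not_avoids_iff {T : Finset ι} {j : ι} {n : ℕ} {ys : Fin n → ι} :
    ¬ Avoids T j ys ↔ j ∈ T ∨ ∃ k, ys k ∈ T := by
  simp only [Avoids, not_and_or, not_forall, not_not]

/-- AGREEMENT OFF `T` ⇒ EQUAL ORDERED PRODUCTS along a tuple with no entry in `T`. [folklore] -/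
theorem bprod_congr_off {b b' : ι → R} {T : Finset ι} (hb : ∀ i ∉ T, b i = b' i) :
    ∀ (n : ℕ) (ys : Fin n → ι), (∀ k, ys k ∉ T) → bprod b n ys = bprod b' n ys := by
  intro n
  induction n with
  | zero => intro ys _; rw [bprod_zero, bprod_zero]
  | succ n ih =>
      intro ys h
      rw [bprod_succ, bprod_succ, hb _ (h 0), ih (Fin.tail ys) fun k => h k.succ]

/-- **THE CANCELLING TERMS**: if the two factor families agree off `T` (`a = a'`, `b = b'` at every label not in
`T`), the two path terms of a walk AVOIDING `T` coincide — *"The terms with ω such that □_{ω_i} are interior cubes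
of Ω are the same in both representations"*. [cite: Balaban1983RegularityDecay, p.579 after (2.22)] -/
theorem path_term_congr_off {a a' b b' : ι → R} {T : Finset ι} (ha : ∀ i ∉ T, a i = a' i)
    (hb : ∀ i ∉ T, b i = b' i) {j : ι} {n : ℕ} {ys : Fin n → ι} (h : Avoids T j ys) :
    a j * bprod b n ys = a' j * bprod b' n ys := by
  rw [ha j h.1, bprod_congr_off hb n ys h.2]

/-- **CUT-OFFS**: a single cut path term `P · a ω₀ · b ω₁ ⋯ b ω_n · P'` vanishes unless the walk starts in `S₀` and
ends in `S₁` (`P` kills `a i` off `S₀`; `P'` kills `a i`, `b i` off `S₁`). [cite: Balaban1983RegularityDecay, p.579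
"x, x' ∈ □_{ω₀}, supp f ⊂ □_{ω_n}"] -/
theorem cut_path_term_eq_zero {a b : ι → R} {P P' : R} {S₀ S₁ : Finset ι}
    (hP : ∀ i ∉ S₀, P * a i = 0) (hP'a : ∀ i ∉ S₁, a i * P' = 0) (hP'b : ∀ i ∉ S₁, b i * P' = 0) :
    ∀ (n : ℕ) (i : ι) (ys : Fin n → ι), (i ∉ S₀ ∨ lastPt i n ys ∉ S₁) →
      P * a i * bprod b n ys * P' = 0 := by
  intro n i ys h
  rcases h with hi | hl
  · rw [hP i hi, zero_mul, zero_mul]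
  · cases n with
    | zero =>
        rw [lastPt_zero] at hl
        rw [bprod_zero, mul_one, mul_assoc, hP'a i hl, mul_zero]
    | succ m => exact mul_bprod_mul_eq_zero_of_last b m (P * a i) ys (hP'b _ hl)

end Tuples

/-! ### §2 Cancellation: the order-`n` term of the difference is a sum over walks through `T` -/

section Sums

variable {R : Type*} [Ring R] {ι : Type*} [Fintype ι] [DecidableEq ι]

/-- **CANCELLATION (the `δG_k` representation).** For two LOCAL factor families agreeing off `T`, the order-`n` term
of the difference of the two Neumann series (2.12), cut off on both sides, is the sum over the walks NOT avoiding
`T` of the difference of the two path terms — *"they cancel in the difference, and for δG_k we get a representation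
similar to (2.13) with the additional restriction that at least one □_{ω_i} intersects the boundary ∂Ω"*.
[cite: Balaban1983RegularityDecay, p.579 after (2.22); (2.13) p.577] -/
theorem diff_cut_order_term_eq (adj : ι → ι → Prop) [DecidableRel adj] {a b a' b' : ι → R} {T : Finset ι}
    (hab : ∀ i l, ¬ adj i l → a i * b l = 0) (hbb : ∀ i l, ¬ adj i l → b i * b l = 0)
    (hab' : ∀ i l, ¬ adj i l → a' i * b' l = 0) (hbb' : ∀ i l, ¬ adj i l → b' i * b' l = 0)
    (ha : ∀ i ∉ T, a i = a' i) (hb : ∀ i ∉ T, b i = b' i) (P P' : R) (n : ℕ) :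
    P * ((∑ i, a i) * (∑ i, b i) ^ n - (∑ i, a' i) * (∑ i, b' i) ^ n) * P' =
      ∑ i, ∑ ys ∈ (walks adj i n).filter (fun ys => ¬ Avoids T i ys),
        (P * a i * bprod b n ys * P' - P * a' i * bprod b' n ys * P') := by
  rw [mul_sub, sub_mul, cut_order_term_eq adj hab hbb P P' n, cut_order_term_eq adj hab' hbb' P P' n,
    ← Finset.sum_sub_distrib]
  refine Finset.sum_congr rfl fun i _ => ?_
  rw [← Finset.sum_sub_distrib]
  refine (Finset.sum_filter_of_ne fun ys _ hne => ?_).symm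
  intro hav
  refine hne ?_
  have h : P * a i * bprod b n ys * P' = P * a' i * bprod b' n ys * P' := by
    rw [mul_assoc P (a i), path_term_congr_off ha hb hav, ← mul_assoc]
  rw [h, sub_self]

/-- **TERMS OF ORDER `n < N` OF THE DIFFERENCE VANISH** when every walk from `S₀` ending in `S₁` that does NOT avoid
`T` has at least `N` steps — the printed *"additional restriction"* on the length `n`.
[cite: Balaban1983RegularityDecay, p.579 after (2.22)] -/
theorem diff_cut_order_term_eq_zero (adj : ι → ι → Prop) [DecidableRel adj] {a b a' b' : ι → R} {P P' : R}
    {S₀ S₁ T : Finset ι} {N n : ℕ}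
    (hab : ∀ i l, ¬ adj i l → a i * b l = 0) (hbb : ∀ i l, ¬ adj i l → b i * b l = 0)
    (hab' : ∀ i l, ¬ adj i l → a' i * b' l = 0) (hbb' : ∀ i l, ¬ adj i l → b' i * b' l = 0)
    (ha : ∀ i ∉ T, a i = a' i) (hb : ∀ i ∉ T, b i = b' i)
    (hP : ∀ i ∉ S₀, P * a i = 0) (hPa' : ∀ i ∉ S₀, P * a' i = 0)
    (hP'a : ∀ i ∉ S₁, a i * P' = 0) (hP'b : ∀ i ∉ S₁, b i * P' = 0)
    (hP'a' : ∀ i ∉ S₁, a' i * P' = 0) (hP'b' : ∀ i ∉ S₁, b' i * P' = 0)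
    (hsepT : ∀ (n : ℕ) (i : ι), i ∈ S₀ → ∀ ys : Fin n → ι, IsWalk adj i ys → lastPt i n ys ∈ S₁ →
      ¬ Avoids T i ys → N ≤ n)
    (hn : n < N) :
    P * ((∑ i, a i) * (∑ i, b i) ^ n - (∑ i, a' i) * (∑ i, b' i) ^ n) * P' = 0 := by
  rw [diff_cut_order_term_eq adj hab hbb hab' hbb' ha hb P P' n]
  refine Finset.sum_eq_zero fun i _ => Finset.sum_eq_zero fun ys hys => ?_
  rw [Finset.mem_filter, mem_walks] at hys
  by_cases hi : i ∈ S₀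
  · by_cases hl : lastPt i n ys ∈ S₁
    · exact absurd (hsepT n i hi ys hys.1 hl hys.2) (not_le.mpr hn)
    · rw [cut_path_term_eq_zero hP hP'a hP'b n i ys (Or.inr hl),
        cut_path_term_eq_zero hPa' hP'a' hP'b' n i ys (Or.inr hl), sub_self]
  · rw [cut_path_term_eq_zero hP hP'a hP'b n i ys (Or.inl hi),
      cut_path_term_eq_zero hPa' hP'a' hP'b' n i ys (Or.inl hi), sub_self]

end Sums

/-! ### §3 Normed ring: the bound for the difference, *"with 2^{d+1} instead of 2^d"* -/

section Normed

variable {R : Type*} [NormedRing R] {ι : Type*} [Fintype ι] [DecidableEq ι]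

/-- **NORM OF THE ORDER-`(m+1)` TERM OF THE DIFFERENCE**: `≤ 2·|S₀|·D^{m+1}·αβ^mβ₁` — each of the two expansions
contributes the bound of `B4RandomWalk213.norm_cut_order_term_le`; the printed *"2^{d+1} instead of 2^d"*.
[cite: Balaban1983RegularityDecay, p.579 after (2.22)] -/
theorem norm_diff_cut_order_term_le (adj : ι → ι → Prop) [DecidableRel adj] {a b a' b' : ι → R} {P P' : R}
    {S₀ : Finset ι} {α β β₁ : ℝ} {D : ℕ}
    (hab : ∀ i l, ¬ adj i l → a i * b l = 0) (hbb : ∀ i l, ¬ adj i l → b i * b l = 0)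
    (hab' : ∀ i l, ¬ adj i l → a' i * b' l = 0) (hbb' : ∀ i l, ¬ adj i l → b' i * b' l = 0)
    (hP : ∀ i ∉ S₀, P * a i = 0) (hPa' : ∀ i ∉ S₀, P * a' i = 0)
    (hα : ∀ i, ‖P * a i‖ ≤ α) (hα' : ∀ i, ‖P * a' i‖ ≤ α)
    (hβ : ∀ i, ‖b i‖ ≤ β) (hβ' : ∀ i, ‖b' i‖ ≤ β)
    (hβ₁ : ∀ i, ‖b i * P'‖ ≤ β₁) (hβ₁' : ∀ i, ‖b' i * P'‖ ≤ β₁)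
    (hD : ∀ j, (Finset.univ.filter fun i => adj j i).card ≤ D) (m : ℕ) :
    ‖P * ((∑ i, a i) * (∑ i, b i) ^ (m + 1) - (∑ i, a' i) * (∑ i, b' i) ^ (m + 1)) * P'‖ ≤
      2 * (S₀.card * (D : ℝ) ^ (m + 1) * (α * β ^ m * β₁)) := by
  rw [mul_sub, sub_mul, two_mul]
  exact (norm_sub_le _ _).trans (add_le_add (norm_cut_order_term_le adj hab hbb hP hα hβ hβ₁ hD m)
    (norm_cut_order_term_le adj hab' hbb' hPa' hα' hβ' hβ₁' hD m))

/-- **THE `δG_k` BOUND, ABSTRACT FORM.** Let `G = Σ_n G₀Rⁿ` and `G' = Σ_n G₀'R'ⁿ` be two convergent Neumann series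
(2.12) built from LOCAL factor families `(a, b)`, `(a', b')` over the same labels which AGREE off a label set `T`;
let `P`, `P'` cut off `a, a'` outside `S₀` on the left and `a, a', b, b'` outside `S₁` on the right, with the norm
bounds `α, β, β₁` of `B4RandomWalk213.walk_decay_bound` for both families, out-degree `≤ D`, `Dβ < 1`; and suppose
every walk from `S₀` to `S₁` THROUGH `T` (i.e. not avoiding `T`) has at least `N ≥ 1` steps. Then
`‖P (G − G') P'‖ ≤ 2 · |S₀| · α · β₁ · D · (Dβ)^{N−1} / (1 − Dβ)` — *"we get the first inequality in (2.22) with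
2^{d+1} instead of 2^d and with the restriction n ≥ M^{−1} sup_{x₁∈Ω^c}* ⟦sic: inf⟧ *(dist({x,x'},x₁) +
dist(x₁, supp f)) − 3"*.
[cite: Balaban1983RegularityDecay, p.579 after (2.22); (1.11)–(1.12) p.573; Corollary 2.3 p.581] -/
theorem walk_delta_bound (adj : ι → ι → Prop) [DecidableRel adj]
    {a b a' b' : ι → R} {G G' G₀ G₀' Rop Rop' P P' : R} {S₀ S₁ T : Finset ι} {α β β₁ : ℝ} {D N : ℕ}
    (hG₀ : G₀ = ∑ i, a i) (hRop : Rop = ∑ i, b i) (hG₀' : G₀' = ∑ i, a' i) (hRop' : Rop' = ∑ i, b' i)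
    (hG : HasSum (fun n : ℕ => G₀ * Rop ^ n) G) (hG' : HasSum (fun n : ℕ => G₀' * Rop' ^ n) G')
    (hab : ∀ i l, ¬ adj i l → a i * b l = 0) (hbb : ∀ i l, ¬ adj i l → b i * b l = 0)
    (hab' : ∀ i l, ¬ adj i l → a' i * b' l = 0) (hbb' : ∀ i l, ¬ adj i l → b' i * b' l = 0)
    (ha : ∀ i ∉ T, a i = a' i) (hb : ∀ i ∉ T, b i = b' i)
    (hP : ∀ i ∉ S₀, P * a i = 0) (hPa' : ∀ i ∉ S₀, P * a' i = 0)
    (hP'a : ∀ i ∉ S₁, a i * P' = 0) (hP'b : ∀ i ∉ S₁, b i * P' = 0)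
    (hP'a' : ∀ i ∉ S₁, a' i * P' = 0) (hP'b' : ∀ i ∉ S₁, b' i * P' = 0)
    (hα : ∀ i, ‖P * a i‖ ≤ α) (hα' : ∀ i, ‖P * a' i‖ ≤ α) (hβ0 : 0 ≤ β)
    (hβ : ∀ i, ‖b i‖ ≤ β) (hβ' : ∀ i, ‖b' i‖ ≤ β) (hβ₁ : ∀ i, ‖b i * P'‖ ≤ β₁) (hβ₁' : ∀ i, ‖b' i * P'‖ ≤ β₁)
    (hD : ∀ j, (Finset.univ.filter fun i => adj j i).card ≤ D) (hDβ : (D : ℝ) * β < 1) (hN : 1 ≤ N)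
    (hsepT : ∀ (n : ℕ) (i : ι), i ∈ S₀ → ∀ ys : Fin n → ι, IsWalk adj i ys → lastPt i n ys ∈ S₁ →
      ¬ Avoids T i ys → N ≤ n) :
    ‖P * (G - G') * P'‖ ≤ 2 * (S₀.card * α * β₁ * D * ((D : ℝ) * β) ^ (N - 1) / (1 - D * β)) := by
  obtain ⟨N', rfl⟩ : ∃ N', N = N' + 1 := ⟨N - 1, by omega⟩
  rw [Nat.add_sub_cancel]
  subst hG₀ hRop hG₀' hRop'
  -- the two series (2.12), subtracted and cut off on both sides
  have hf : HasSum (fun n : ℕ => P * ((∑ i, a i) * (∑ i, b i) ^ n - (∑ i, a' i) * (∑ i, b' i) ^ n) * P')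
      (P * (G - G') * P') :=
    ((hG.sub hG').mul_left P).mul_right P'
  -- the terms of order < N vanish: pass to the tail
  have h0 : ∑ n ∈ Finset.range (N' + 1),
      P * ((∑ i, a i) * (∑ i, b i) ^ n - (∑ i, a' i) * (∑ i, b' i) ^ n) * P' = 0 :=
    Finset.sum_eq_zero fun n hn =>
      diff_cut_order_term_eq_zero adj hab hbb hab' hbb' ha hb hP hPa' hP'a hP'b hP'a' hP'b' hsepT
        (Finset.mem_range.mp hn)
  have hf' : HasSum (fun m : ℕ =>
      P * ((∑ i, a i) * (∑ i, b i) ^ (m + (N' + 1)) - (∑ i, a' i) * (∑ i, b' i) ^ (m + (N' + 1))) * P')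
      (P * (G - G') * P') := by
    have h := (hasSum_nat_add_iff' (N' + 1)).mpr hf
    rw [h0, sub_zero] at h
    exact h
  -- geometric majorant
  have hr0 : 0 ≤ (D : ℝ) * β := mul_nonneg (Nat.cast_nonneg _) hβ0
  have hg : HasSum (fun m : ℕ => 2 * (S₀.card * α * β₁ * D * ((D : ℝ) * β) ^ N') * ((D : ℝ) * β) ^ m)
      (2 * (S₀.card * α * β₁ * D * ((D : ℝ) * β) ^ N') * (1 - (D : ℝ) * β)⁻¹) :=
    (hasSum_geometric_of_lt_one hr0 hDβ).mul_left _
  have hbound : ∀ m : ℕ,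
      ‖P * ((∑ i, a i) * (∑ i, b i) ^ (m + (N' + 1)) - (∑ i, a' i) * (∑ i, b' i) ^ (m + (N' + 1))) * P'‖
        ≤ 2 * (S₀.card * α * β₁ * D * ((D : ℝ) * β) ^ N') * ((D : ℝ) * β) ^ m := fun m => by
    rw [← Nat.add_assoc m N' 1]
    refine (norm_diff_cut_order_term_le adj hab hbb hab' hbb' hP hPa' hα hα' hβ hβ' hβ₁ hβ₁' hD
      (m + N')).trans (le_of_eq ?_)
    ring
  calc ‖P * (G - G') * P'‖ ≤ 2 * (S₀.card * α * β₁ * D * ((D : ℝ) * β) ^ N') * (1 - (D : ℝ) * β)⁻¹ :=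
        hf'.norm_le_of_bounded hg hbound
    _ = 2 * (S₀.card * α * β₁ * D * ((D : ℝ) * β) ^ N' / (1 - D * β)) := by
        rw [div_eq_mul_inv]; ring

/-- the same bound in EXPONENTIAL form: if `Dβ ≤ e^{−δ}` with `δ > 0` then
`‖P (G − G') P'‖ ≤ 2·|S₀|αβ₁D(1 − e^{−δ})^{−1} · e^{−δ(N−1)}` — with `N − 1 ≥` (steps from `S₀` through `T` to `S₁`)
this is the *"additional factor"* `e^{−δ₀(dist(supp f,Ω^c) + dist(supp f',Ω^c))}` of (1.12) / Corollary 2.3 on top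
of `e^{−δ₀dist(supp f, supp f')}`, after the halving of the rate recorded in the printed `(2M)^{−1}`.
[cite: Balaban1983RegularityDecay, (1.12) p.573, p.579 after (2.22), Corollary 2.3 p.581] -/
theorem walk_delta_bound_exp (adj : ι → ι → Prop) [DecidableRel adj]
    {a b a' b' : ι → R} {G G' G₀ G₀' Rop Rop' P P' : R} {S₀ S₁ T : Finset ι} {α β β₁ δ : ℝ} {D N : ℕ}
    (hG₀ : G₀ = ∑ i, a i) (hRop : Rop = ∑ i, b i) (hG₀' : G₀' = ∑ i, a' i) (hRop' : Rop' = ∑ i, b' i)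
    (hG : HasSum (fun n : ℕ => G₀ * Rop ^ n) G) (hG' : HasSum (fun n : ℕ => G₀' * Rop' ^ n) G')
    (hab : ∀ i l, ¬ adj i l → a i * b l = 0) (hbb : ∀ i l, ¬ adj i l → b i * b l = 0)
    (hab' : ∀ i l, ¬ adj i l → a' i * b' l = 0) (hbb' : ∀ i l, ¬ adj i l → b' i * b' l = 0)
    (ha : ∀ i ∉ T, a i = a' i) (hb : ∀ i ∉ T, b i = b' i)
    (hP : ∀ i ∉ S₀, P * a i = 0) (hPa' : ∀ i ∉ S₀, P * a' i = 0)
    (hP'a : ∀ i ∉ S₁, a i * P' = 0) (hP'b : ∀ i ∉ S₁, b i * P' = 0)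
    (hP'a' : ∀ i ∉ S₁, a' i * P' = 0) (hP'b' : ∀ i ∉ S₁, b' i * P' = 0)
    (hα : ∀ i, ‖P * a i‖ ≤ α) (hα' : ∀ i, ‖P * a' i‖ ≤ α) (hβ0 : 0 ≤ β)
    (hβ : ∀ i, ‖b i‖ ≤ β) (hβ' : ∀ i, ‖b' i‖ ≤ β) (hβ₁ : ∀ i, ‖b i * P'‖ ≤ β₁) (hβ₁' : ∀ i, ‖b' i * P'‖ ≤ β₁)
    (hD : ∀ j, (Finset.univ.filter fun i => adj j i).card ≤ D) (hδ : 0 < δ)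
    (hDβ : (D : ℝ) * β ≤ Real.exp (-δ)) (hN : 1 ≤ N)
    (hsepT : ∀ (n : ℕ) (i : ι), i ∈ S₀ → ∀ ys : Fin n → ι, IsWalk adj i ys → lastPt i n ys ∈ S₁ →
      ¬ Avoids T i ys → N ≤ n) :
    ‖P * (G - G') * P'‖ ≤
      2 * (S₀.card * α * β₁ * D / (1 - Real.exp (-δ)) * Real.exp (-(δ * ((N - 1 : ℕ) : ℝ)))) := by
  have he1 : Real.exp (-δ) < 1 := Real.exp_lt_one_iff.mpr (neg_lt_zero.mpr hδ)
  have hr0 : 0 ≤ (D : ℝ) * β := mul_nonneg (Nat.cast_nonneg _) hβ0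
  have hDβ1 : (D : ℝ) * β < 1 := hDβ.trans_lt he1
  have h := walk_delta_bound adj hG₀ hRop hG₀' hRop' hG hG' hab hbb hab' hbb' ha hb hP hPa' hP'a hP'b hP'a'
    hP'b' hα hα' hβ0 hβ hβ' hβ₁ hβ₁' hD hDβ1 hN hsepT
  have hK : 0 ≤ (S₀.card : ℝ) * α * β₁ * D := by
    rcases S₀.eq_empty_or_nonempty with hS | ⟨i, _⟩
    · simp [hS]
    · exact mul_nonneg (mul_nonneg (mul_nonneg (Nat.cast_nonneg _) ((norm_nonneg _).trans (hα i)))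
        ((norm_nonneg _).trans (hβ₁ i))) (Nat.cast_nonneg _)
  have hpow : ((D : ℝ) * β) ^ (N - 1) ≤ Real.exp (-(δ * ((N - 1 : ℕ) : ℝ))) := by
    rw [show -(δ * ((N - 1 : ℕ) : ℝ)) = ((N - 1 : ℕ) : ℝ) * (-δ) by ring, Real.exp_nat_mul]
    exact pow_le_pow_left₀ hr0 hDβ _
  have hinv : (1 - (D : ℝ) * β)⁻¹ ≤ (1 - Real.exp (-δ))⁻¹ :=
    inv_anti₀ (by linarith) (by linarith)
  calc ‖P * (G - G') * P'‖ ≤ 2 * (S₀.card * α * β₁ * D * ((D : ℝ) * β) ^ (N - 1) / (1 - D * β)) := h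
    _ = 2 * (S₀.card * α * β₁ * D * (1 - (D : ℝ) * β)⁻¹ * ((D : ℝ) * β) ^ (N - 1)) := by
        rw [div_eq_mul_inv]; ring
    _ ≤ 2 * (S₀.card * α * β₁ * D * (1 - Real.exp (-δ))⁻¹ * Real.exp (-(δ * ((N - 1 : ℕ) : ℝ)))) :=
        mul_le_mul_of_nonneg_left
          (mul_le_mul (mul_le_mul_of_nonneg_left hinv hK) hpow (pow_nonneg hr0 _)
            (mul_nonneg hK (inv_nonneg.mpr (by linarith))))
          (by norm_num)
    _ = 2 * (S₀.card * α * β₁ * D / (1 - Real.exp (-δ)) * Real.exp (-(δ * ((N - 1 : ℕ) : ℝ)))) := by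
        rw [div_eq_mul_inv]

end Normed

/-! ### §4 The `ℤ^d` model: intermediate displacement, length of walks through `T`, the metric step -/

section Lattice

variable {ι : Type*} {d : ℕ}

/-- **PREFIX DISPLACEMENT**: along a cube-walk `(j, ys)` the `k`-th later point `ys k` (the `(k+1)`-st point of the
path) is within sup-distance `k + 1` of the start. [folklore] -/
theorem prefix_displacement (pos : ι → Fin d → ℤ) :
    ∀ (n : ℕ) (j : ι) (ys : Fin n → ι), IsWalk (cubeAdj pos) j ys →
      ∀ (k : Fin n) (μ : Fin d), |pos j μ - pos (ys k) μ| ≤ (k : ℕ) + 1 := by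
  intro n
  induction n with
  | zero => intro j ys _ k; exact k.elim0
  | succ n ih =>
      intro j ys hw k μ
      rw [isWalk_succ] at hw
      refine Fin.cases ?_ (fun k' => ?_) k
      · have h1 : |pos j μ - pos (ys 0) μ| ≤ 1 := hw.1 μ
        simpa using h1
      · have h1 : |pos j μ - pos (ys 0) μ| ≤ 1 := hw.1 μ
        have h2 := ih (ys 0) (Fin.tail ys) hw.2 k' μ
        have h3 : Fin.tail ys k' = ys k'.succ := rfl
        rw [h3] at h2
        calc |pos j μ - pos (ys k'.succ) μ|
            ≤ |pos j μ - pos (ys 0) μ| + |pos (ys 0) μ - pos (ys k'.succ) μ| := abs_sub_le _ _ _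
          _ ≤ 1 + ((k' : ℕ) + 1 : ℤ) := add_le_add h1 (by exact_mod_cast h2)
          _ = ((k'.succ : ℕ) : ℤ) + 1 := by push_cast [Fin.val_succ]; ring

/-- **SUFFIX DISPLACEMENT**: along a cube-walk `(j, ys)` of length `n` the point `ys k` is within sup-distance
`n − 1 − k` of the end-point `ω_n`. [folklore] -/
theorem suffix_displacement (pos : ι → Fin d → ℤ) :
    ∀ (n : ℕ) (j : ι) (ys : Fin n → ι), IsWalk (cubeAdj pos) j ys →
      ∀ (k : Fin n) (μ : Fin d), |pos (ys k) μ - pos (lastPt j n ys) μ| ≤ (n : ℤ) - 1 - (k : ℕ) := by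
  intro n
  induction n with
  | zero => intro j ys _ k; exact k.elim0
  | succ n ih =>
      intro j ys hw k μ
      rw [isWalk_succ] at hw
      refine Fin.cases ?_ (fun k' => ?_) k
      · have h2 := walk_displacement pos n (ys 0) (Fin.tail ys) hw.2 μ
        rw [lastPt_tail] at h2
        have h3 : ((n + 1 : ℕ) : ℤ) - 1 - ((0 : Fin (n + 1)) : ℕ) = n := by push_cast; simp
        rw [h3]
        exact h2
      · have h2 := ih (ys 0) (Fin.tail ys) hw.2 k' μ
        rw [lastPt_tail] at h2
        have h3 : Fin.tail ys k' = ys k'.succ := rfl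
        rw [h3] at h2
        have h4 : ((n + 1 : ℕ) : ℤ) - 1 - ((k'.succ : Fin (n + 1)) : ℕ) = (n : ℤ) - 1 - (k' : ℕ) := by
          push_cast [Fin.val_succ]; ring
        rw [h4]
        exact h2

/-- **THROUGH `T` ⇒ LENGTH.** If `N ≤ d(i,t) + d(t,l)` for all `i ∈ S₀`, `t ∈ T`, `l ∈ S₁` (sup-distances of the
labels in `ℤ^d`, each witnessed by one coordinate), then every cube-walk from `S₀` ending in `S₁` which does not
avoid `T` has at least `N` steps — the printed restriction *"n ≥ M^{−1} sup_{x₁∈Ω^c}* ⟦sic: inf⟧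
*(dist({x,x'},x₁) + dist(x₁, supp f)) − 3"*. [cite: Balaban1983RegularityDecay, p.579 after (2.22)] -/
theorem le_length_of_through (pos : ι → Fin d → ℤ) {S₀ S₁ T : Finset ι} {N : ℕ}
    (hsep : ∀ i ∈ S₀, ∀ t ∈ T, ∀ l ∈ S₁, ∃ μ ν, (N : ℤ) ≤ |pos i μ - pos t μ| + |pos t ν - pos l ν|) :
    ∀ (n : ℕ) (i : ι), i ∈ S₀ → ∀ ys : Fin n → ι, IsWalk (cubeAdj pos) i ys →
      lastPt i n ys ∈ S₁ → ¬ Avoids T i ys → N ≤ n := by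
  intro n i hi ys hw hl hT
  rw [not_avoids_iff] at hT
  rcases hT with hiT | ⟨k, hk⟩
  · obtain ⟨μ, ν, h⟩ := hsep i hi i hiT _ hl
    have h1 : |pos i μ - pos i μ| = 0 := by simp
    have h2 := walk_displacement pos n i ys hw ν
    have : (N : ℤ) ≤ n := by linarith
    exact_mod_cast this
  · obtain ⟨μ, ν, h⟩ := hsep i hi (ys k) hk _ hl
    have h1 := prefix_displacement pos n i ys hw k μ
    have h2 := suffix_displacement pos n i ys hw k ν
    have : (N : ℤ) ≤ n := by
      have h1' : |pos i μ - pos (ys k) μ| ≤ ((k : ℕ) : ℤ) + 1 := by exact_mod_cast h1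
      linarith
    exact_mod_cast this

/-- the hypothesis of `le_length_of_through` from two one-sided separations: if `S₀` is at sup-distance `≥ N₀`
from `T` and `T` at sup-distance `≥ N₁` from `S₁`, then `N₀ + N₁ ≤ d(i,t) + d(t,l)` — the two printed depth
terms `dist({x,x'}, Ω^c)`, `dist(supp f, Ω^c)`. [cite: Balaban1983RegularityDecay, p.579 after (2.22)] -/
theorem through_of_separations (pos : ι → Fin d → ℤ) {S₀ S₁ T : Finset ι} {N₀ N₁ : ℕ}
    (h₀ : ∀ i ∈ S₀, ∀ t ∈ T, ∃ μ, (N₀ : ℤ) ≤ |pos i μ - pos t μ|)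
    (h₁ : ∀ t ∈ T, ∀ l ∈ S₁, ∃ ν, (N₁ : ℤ) ≤ |pos t ν - pos l ν|) :
    ∀ i ∈ S₀, ∀ t ∈ T, ∀ l ∈ S₁, ∃ μ ν, ((N₀ + N₁ : ℕ) : ℤ) ≤ |pos i μ - pos t μ| + |pos t ν - pos l ν| := by
  intro i hi t ht l hl
  obtain ⟨μ, hμ⟩ := h₀ i hi t ht
  obtain ⟨ν, hν⟩ := h₁ t ht l hl
  exact ⟨μ, ν, by push_cast; linarith⟩

/-- **THE `δG_k` CLAUSE OF COROLLARY 2.3, ABSTRACT `ℤ^d` FORM**: the bound of §3 for the printed cube adjacency with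
`D = 3^d`, the length restriction expressed by `N ≤ d(S₀,t) + d(t,S₁)` for every `t ∈ T` (`N ≥ 1`):
`‖P (G − G') P'‖ ≤ 2·|S₀|·α·β₁·3^d·(3^dβ)^{N−1}/(1 − 3^dβ)`. All operator-theoretic inputs (both series (2.12),
locality of both families, their agreement off `T`, the Lemma 2.1-type bounds, `3^dβ < 1`) are hypotheses.
[cite: Balaban1983RegularityDecay, (1.11)–(1.12) p.573, p.579 after (2.22), Corollary 2.3 p.581] -/
theorem lattice_walk_delta_bound {R : Type*} [NormedRing R] [Fintype ι] [DecidableEq ι]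
    (pos : ι → Fin d → ℤ) (hpos : Function.Injective pos)
    {a b a' b' : ι → R} {G G' G₀ G₀' Rop Rop' P P' : R} {S₀ S₁ T : Finset ι} {α β β₁ : ℝ} {N : ℕ}
    (hG₀ : G₀ = ∑ i, a i) (hRop : Rop = ∑ i, b i) (hG₀' : G₀' = ∑ i, a' i) (hRop' : Rop' = ∑ i, b' i)
    (hG : HasSum (fun n : ℕ => G₀ * Rop ^ n) G) (hG' : HasSum (fun n : ℕ => G₀' * Rop' ^ n) G')
    (hab : ∀ i l, ¬ cubeAdj pos i l → a i * b l = 0) (hbb : ∀ i l, ¬ cubeAdj pos i l → b i * b l = 0)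
    (hab' : ∀ i l, ¬ cubeAdj pos i l → a' i * b' l = 0) (hbb' : ∀ i l, ¬ cubeAdj pos i l → b' i * b' l = 0)
    (ha : ∀ i ∉ T, a i = a' i) (hb : ∀ i ∉ T, b i = b' i)
    (hP : ∀ i ∉ S₀, P * a i = 0) (hPa' : ∀ i ∉ S₀, P * a' i = 0)
    (hP'a : ∀ i ∉ S₁, a i * P' = 0) (hP'b : ∀ i ∉ S₁, b i * P' = 0)
    (hP'a' : ∀ i ∉ S₁, a' i * P' = 0) (hP'b' : ∀ i ∉ S₁, b' i * P' = 0)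
    (hα : ∀ i, ‖P * a i‖ ≤ α) (hα' : ∀ i, ‖P * a' i‖ ≤ α) (hβ0 : 0 ≤ β)
    (hβ : ∀ i, ‖b i‖ ≤ β) (hβ' : ∀ i, ‖b' i‖ ≤ β) (hβ₁ : ∀ i, ‖b i * P'‖ ≤ β₁) (hβ₁' : ∀ i, ‖b' i * P'‖ ≤ β₁)
    (h3β : (3 : ℝ) ^ d * β < 1) (hN : 1 ≤ N)
    (hsep : ∀ i ∈ S₀, ∀ t ∈ T, ∀ l ∈ S₁, ∃ μ ν, (N : ℤ) ≤ |pos i μ - pos t μ| + |pos t ν - pos l ν|) :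
    ‖P * (G - G') * P'‖ ≤
      2 * (S₀.card * α * β₁ * (3 : ℝ) ^ d * ((3 : ℝ) ^ d * β) ^ (N - 1) / (1 - (3 : ℝ) ^ d * β)) := by
  have h := walk_delta_bound (cubeAdj pos) hG₀ hRop hG₀' hRop' hG hG' hab hbb hab' hbb' ha hb hP hPa' hP'a hP'b
    hP'a' hP'b' hα hα' hβ0 hβ hβ' hβ₁ hβ₁' (card_cubeAdj_le pos hpos) (D := 3 ^ d) (by exact_mod_cast h3β) hN
    (le_length_of_through pos hsep)
  exact_mod_cast h

/-- **THE PRINTED SECOND STEP** for the restriction on `n`: for a point `x₁` of `C` (↦ `Ω^c`),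
`(dist(x,y) + dist(x,C) + dist(y,C))/2 ≤ dist(x,x₁) + dist(x₁,y)`, by the triangle inequality; taking the infimum
over `x₁ ∈ C` (and over the points of the two sets) this is the printed *"M^{−1} sup_{x₁∈Ω^c}* ⟦sic: inf⟧
*(dist({x,x'},x₁) + dist(x₁, supp f)) − 3 ≥ (2M)^{−1}(dist({x,x'}, supp f) + dist({x,x'}, Ω^c) +
dist(supp f, Ω^c)) − 3"*. [cite: Balaban1983RegularityDecay, p.579 after (2.22)] -/
theorem half_sum_le_dist_through {X : Type*} [PseudoMetricSpace X] {C : Set X} {x₁ : X} (h₁ : x₁ ∈ C)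
    (x y : X) : (dist x y + Metric.infDist x C + Metric.infDist y C) / 2 ≤ dist x x₁ + dist x₁ y := by
  have h1 := dist_triangle x x₁ y
  have h2 : Metric.infDist x C ≤ dist x x₁ := Metric.infDist_le_dist_of_mem h₁
  have h3 : Metric.infDist y C ≤ dist y x₁ := Metric.infDist_le_dist_of_mem h₁
  rw [dist_comm y x₁] at h3
  linarith

end Lattice

end Literature.MathematicalPhysics.QuantumFieldTheory.Balaban1983to89.B4RandomWalkDelta112
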